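import Literature.AnabelianGeometry.EtaleTheta.SettingModelChiThetaTopology
import Literature.AnabelianGeometry.EtaleTheta.SettingModelChiSemidirect
import Literature.AnabelianGeometry.EtaleTheta.SettingModel2Curve
import Literature.AnabelianGeometry.SemiGraphs.TemperedFibreProductCompletion
import Literature.AnabelianGeometry.AbsoluteAnabelian.GaloisSubextensionProofs
import Mathlib.Topology.Algebra.ClopenNhdofOne
import HarnessLib

/-!
# The graph of `F` is DENSE in the fibre product `Γ = P ×_Z ℤ`; `Γ = F̂₂ ×_Ẑ ℤ` and `Δ^tp_X` of the χ-twisted model are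
# TOPOLOGICALLY FINITELY GENERATED (non-vacuity of the parameter «`Δ^tp_X` tfg»)

Mochizuki, *Semi-graphs of anabelioids*, Publ. RIMS **42** (2006), Prop. 3.6 (iii) p. 38 ("`π₁^temp ↪ π̂₁`"), Ex. 3.10 p. 43
[cite: MochizukiSemiAnbd2006, Ex 3.10 p.43]; [EtTh] §1 p. 12 ("`Δ_X` … a profinite free group on 2 generators")
[cite: MochizukiEtTh2009, §1 p.12]; [AbsTopI] §0 p. 8 («topologically finitely generated») [cite: MochizukiAbsTopI2012, §0 p.8].

PROOF-ONLY (abc-iut cell, seat abc-iut-w5-d233 gen 4; theorems only, no definitions).  Purpose: the seat's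
`ThetaSettingCompletionPackage.lean` (p441904) discharges the `Δ`-tfg half of the [AbsTopI] Thm 2.6 (v) regime at the genuine
[IUTchII] §1 setting from the interface PARAMETER «`Δ^tp_X` topologically finitely generated» of the genuine tempered `π₁`.
This file WITNESSES that parameter at the tree's genuine model: abc-iut-L2's χ-twisted theta setting `ThetaSetting.modelχ p`
(`Π^tp_X := (F̂₂ ×_Ẑ ℤ) ⋊_χ G_{ℚ_p}`, `Δ^tp_X ≃ Γ := F̂₂ ×_Ẑ ℤ`), so that «tempered ∧ Galois-countable ∧ `Δ^tp` tfg» is JOINTLY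
SATISFIABLE over the [EtTh] §1 interface (all three hold at `modelχ`).

* `TemperedFibreProduct.denseRange_graph` — GENERIC (abc-iut-w5-d218's fibre-product setting `Γ = P ×_Z ℤ` with dense
  `η : F → P`, `s : F ↠ ℤ`, `e ∘ η = ι ∘ s`, separation of `ι`): the graph homomorphism `g ↦ (η g, s g) : F → Γ` has DENSE range
  (from w5-d218's FIBREWISE density `exists_inv_mul_eta_mem_and_apply_eq` and the basis of open normal subgroups of the
  profinite `P`); `TemperedFibreProduct.isTopologicallyFinitelyGenerated_of_closure_eq_top` — hence `Γ` is topologically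
  finitely generated as soon as `F` is generated by a finite set;
* `SettingModel.isTopologicallyFinitelyGenerated_gfp` — **`Γ = F̂₂ ×_Ẑ ℤ` is topologically generated by the two graph elements
  `(η a, 1)`, `(η b, 0)`** (`F₂ = ⟨a, b⟩`, Mathlib `FreeGroup.closure_range_of`);
* `SettingModel.isTopologicallyFinitelyGenerated_deltaTemp_curveχ` / `…_modelχ` — **`Δ^tp_X` of the χ-twisted tempered curve
  / theta setting is topologically finitely generated** (`Δ^tp_X = inl(Γ) ≃ₜ* Γ`);
* `SettingModel.tfg_parameters_modelχ` — the conjunction «`Π^tp_X` tempered ∧ second countable ∧ `Δ^tp_X` tfg» at `modelχ p`.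

HONEST LABEL: `modelχ` is a semi-synthetic model (consistency evidence for the typed interface, not the tempered fundamental group
of a curve); nothing of [SemiAnbd]/[EtTh] is asserted; nothing here bears on [IUTchIII] Cor. 3.12; no side is taken.
-/

noncomputable section

open Topology Filter Set Function

/-! ### §1. Generic: the graph of `F` is dense in `Γ = P ×_Z ℤ` -/

namespace Literature.AnabelianGeometry.SemiGraphs

namespace TemperedFibreProduct

open Literature.AnabelianGeometry.AbsoluteAnabelian

universe u v w

variable {P : Type u} [Group P] [TopologicalSpace P] [IsTopologicalGroup P] [CompactSpace P]
  [TotallyDisconnectedSpace P]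
variable {Z : Type v} [Group Z] [TopologicalSpace Z]
variable (e : P →ₜ* Z) (ι : Multiplicative ℤ →* Z)
variable (Γ : Subgroup (P × Multiplicative ℤ)) (hΓ : ∀ p, p ∈ Γ ↔ e p.1 = ι p.2)
variable {F : Type w} [Group F] (η : F →* P) (hηd : DenseRange η)
  (s : F →* Multiplicative ℤ) (hs : Surjective s) (hes : ∀ g, e (η g) = ι (s g))
  (hZ : ∀ A : Subgroup (Multiplicative ℤ), A.FiniteIndex →
    ∀ k : Multiplicative ℤ, ι k ∈ closure (ι '' (A : Set (Multiplicative ℤ))) → k ∈ A)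

include hΓ hηd hs hes hZ in
/-- **The graph of `F` is DENSE in `Γ = P ×_Z ℤ`**: every `γ : F →* Γ` with `γ g = (η g, s g)` has dense range.  A basic
neighbourhood of `(x, n) ∈ Γ` is `((x·V) × {n}) ∩ Γ` for an open normal `V ⊴ P` (open normal subgroups are a basis of the profinite
`P`, Mathlib `exist_openNormalSubgroup_sub_open_nhds_of_one`; `ℤ` is discrete), and it contains `(η g, s g)` for the `g` of
abc-iut-w5-d218's fibrewise density `exists_inv_mul_eta_mem_and_apply_eq`. [cite: MochizukiSemiAnbd2006, Prop 3.6(iii) p.38] -/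
theorem denseRange_graph (γ : F →* Γ) (hγ : ∀ g, ((γ g : Γ) : P × Multiplicative ℤ) = (η g, s g)) :
    DenseRange γ := by
  intro q
  rw [mem_closure_iff]
  intro O hO hqO
  obtain ⟨O', hO', rfl⟩ := isOpen_induced_iff.mp hO
  set x : P := (q : P × Multiplicative ℤ).1 with hx
  set n : Multiplicative ℤ := (q : P × Multiplicative ℤ).2 with hn
  have hqxn : ((q : Γ) : P × Multiplicative ℤ) = (x, n) := rfl
  have hcont : Continuous fun y : P => ((x * y, n) : P × Multiplicative ℤ) :=
    (continuous_const.mul continuous_id).prodMk continuous_const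
  have hU : IsOpen ((fun y : P => ((x * y, n) : P × Multiplicative ℤ)) ⁻¹' O') := hO'.preimage hcont
  have h1U : (1 : P) ∈ (fun y : P => ((x * y, n) : P × Multiplicative ℤ)) ⁻¹' O' := by
    rw [Set.mem_preimage, mul_one, ← hqxn]
    exact hqO
  obtain ⟨V, hV⟩ := ProfiniteGrp.exist_openNormalSubgroup_sub_open_nhds_of_one hU h1U
  obtain ⟨g, hgV, hgs⟩ :=
    exists_inv_mul_eta_mem_and_apply_eq e ι η hηd s hs hes hZ V x n ((hΓ _).1 q.2)
  refine ⟨γ g, ?_, ⟨g, rfl⟩⟩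
  have hmem : (x * (x⁻¹ * η g), n) ∈ O' := hV hgV
  rw [mul_inv_cancel_left, ← hgs, ← hγ g] at hmem
  exact hmem

include hΓ hηd hs hes hZ in
/-- **`Γ` is topologically finitely generated as soon as `F` is generated by a finite set** `T`: the graph elements
`(η t, s t)`, `t ∈ T`, generate a subgroup whose closure is `Γ` (density of the graph). [cite: MochizukiAbsTopI2012, §0 p.8] -/
theorem isTopologicallyFinitelyGenerated_of_closure_eq_top (γ : F →* Γ)
    (hγ : ∀ g, ((γ g : Γ) : P × Multiplicative ℤ) = (η g, s g)) (T : Finset F)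
    (hT : Subgroup.closure (T : Set F) = ⊤) : IsTopologicallyFinitelyGenerated Γ := by
  classical
  refine ⟨⟨T.image γ, ?_⟩⟩
  rw [Finset.coe_image, ← MonoidHom.map_closure, hT, ← MonoidHom.range_eq_map]
  apply SetLike.coe_injective
  rw [Subgroup.topologicalClosure_coe, Subgroup.coe_top, MonoidHom.coe_range]
  exact (denseRange_graph e ι Γ hΓ η hηd s hs hes hZ γ hγ).closure_range

end TemperedFibreProduct

end Literature.AnabelianGeometry.SemiGraphs

/-! ### §2. `Γ = F̂₂ ×_Ẑ ℤ` and `Δ^tp_X` of the χ-twisted model -/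

namespace Literature.AnabelianGeometry.EtaleTheta.SettingModel

open Literature.AnabelianGeometry.SemiGraphs Literature.AnabelianGeometry.AbsoluteAnabelian

/-- The graph homomorphism `F₂ → Γ`, `g ↦ (η g, expA g)` (values in `Γ` by `eta_mk_mem_Gfp`), packaged as a bare `MonoidHom`
term inside statements below via `MonoidHom.codRestrict`. [cite: MochizukiEtTh2009, §1 p.12] -/
theorem coe_codRestrict_graph (g : F₂) :
    ((((eta.prod expA).codRestrict Gfp fun g => eta_mk_mem_Gfp g) g : Gfp) : F₂hatT × Multiplicative ℤ) =
      (eta g, expA g) := rfl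

/-- `ι : ℤ ↪ Ẑ` separates finite-index subgroups (abc-iut-w5-d218's `mem_of_toCompletion_mem_closure`).
[cite: MochizukiSemiAnbd2006, §6 p.69] -/
theorem iotaZ_separates : ∀ A : Subgroup (Multiplicative ℤ), A.FiniteIndex →
    ∀ k : Multiplicative ℤ, iotaZ k ∈ closure (iotaZ '' (A : Set (Multiplicative ℤ))) → k ∈ A :=
  fun A hA k hk => by haveI := hA; exact mem_of_toCompletion_mem_closure A k hk

/-- **The graph of `F₂` is dense in `Γ = F̂₂ ×_Ẑ ℤ`.** [cite: MochizukiSemiAnbd2006, Prop 3.6(iii) p.38] -/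
theorem denseRange_graph_gfp : DenseRange ((eta.prod expA).codRestrict Gfp fun g => eta_mk_mem_Gfp g) :=
  TemperedFibreProduct.denseRange_graph eHat iotaZ Gfp mem_Gfp eta denseRange_eta expA expA_surjective eHat_eta
    iotaZ_separates _ coe_codRestrict_graph

/-- **`Γ = F̂₂ ×_Ẑ ℤ` is TOPOLOGICALLY FINITELY GENERATED** — by the two graph elements `(η a, expA a)`, `(η b, expA b)` of the free
generators `a, b` of `F₂` (`FreeGroup.closure_range_of`). [cite: MochizukiAbsTopI2012, §0 p.8] [cite: MochizukiEtTh2009, §1 p.12] -/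
theorem isTopologicallyFinitelyGenerated_gfp : IsTopologicallyFinitelyGenerated Gfp := by
  classical
  refine TemperedFibreProduct.isTopologicallyFinitelyGenerated_of_closure_eq_top eHat iotaZ Gfp mem_Gfp eta denseRange_eta
    expA expA_surjective eHat_eta iotaZ_separates _ coe_codRestrict_graph
    (Finset.univ.image (FreeGroup.of : Fin 2 → F₂)) ?_
  rw [Finset.coe_image, Finset.coe_univ, Set.image_univ]
  exact FreeGroup.closure_range_of _

variable (p : ℕ) [Fact p.Prime]

/-- **`Δ^tp_X` of the χ-twisted tempered curve `curveχ p` is topologically finitely generated**: `Δ^tp_X = {g | g.right = 1} =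
inl(Γ) ≃ₜ* Γ` (the isomorphism of abc-iut-L2's `isSlimGroup_deltaTempχ`). [cite: MochizukiSemiAnbd2006, Ex 3.10 p.43] -/
theorem isTopologicallyFinitelyGenerated_deltaTemp_curveχ : IsTopologicallyFinitelyGenerated (curveχ p).DeltaTemp := by
  let e : Gfp ≃ₜ* (curveχ p).DeltaTemp :=
    { toFun := fun γ => ⟨SemidirectProduct.inl γ, inl_mem_deltaTempχ p γ⟩
      invFun := fun g => g.1.left
      left_inv := fun γ => rfl
      right_inv := fun g => by
        apply Subtype.ext
        change SemidirectProduct.inl g.1.left = g.1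
        have hg : g.1.right = 1 := (mem_deltaTempχ_iff p g.1).mp g.2
        rw [← SemidirectProduct.inl_left_mul_inr_right g.1, hg, map_one, mul_one]
        rfl
      map_mul' := fun a b => Subtype.ext (map_mul _ a b)
      continuous_toFun := (continuous_inlχ p).subtype_mk _
      continuous_invFun :=
        (Semidirect.continuous_left (isInducing_leftRightχ p)).comp continuous_subtype_val }
  exact isTopologicallyFinitelyGenerated_gfp.of_continuousMulEquiv e

/-- **`Δ^tp_X` of the χ-twisted theta setting `ThetaSetting.modelχ p` is topologically finitely generated** (its tempered-curve
layer IS `curveχ p`). [cite: MochizukiSemiAnbd2006, Ex 3.10 p.43] -/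
theorem isTopologicallyFinitelyGenerated_deltaTemp_modelχ :
    IsTopologicallyFinitelyGenerated (ThetaSetting.modelχ p).DeltaTemp :=
  isTopologicallyFinitelyGenerated_deltaTemp_curveχ p

/-- **JOINT SATISFIABILITY of the three interface parameters** used by abc-iut-w5-d233's (H1) reduction at a named completion
package: at `modelχ p`, `Π^tp_X` is tempered, second countable (hence first countable), and `Δ^tp_X` is topologically finitely
generated. [cite: MochizukiSemiAnbd2006, Ex 3.10 p.43] -/
theorem tfg_parameters_modelχ :
    IsTempered (ThetaSetting.modelχ p).PiTemp ∧ SecondCountableTopology (ThetaSetting.modelχ p).PiTemp ∧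
      IsTopologicallyFinitelyGenerated (ThetaSetting.modelχ p).DeltaTemp :=
  ⟨isTempered_piTemp_modelχ p, secondCountableTopology_piTemp_modelχ p, isTopologicallyFinitelyGenerated_deltaTemp_modelχ p⟩

/-- ∃-form over the [EtTh] §1 interface: SOME theta setting has tempered, Galois-countable `Π^tp_X` with topologically finitely
generated `Δ^tp_X`. [cite: MochizukiSemiAnbd2006, Ex 3.10 p.43] -/
theorem exists_thetaSetting_tfg_parameters :
    ∃ D : ThetaSetting p, IsTempered D.PiTemp ∧ SecondCountableTopology D.PiTemp ∧
      IsTopologicallyFinitelyGenerated D.DeltaTemp :=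
  ⟨ThetaSetting.modelχ p, tfg_parameters_modelχ p⟩

end Literature.AnabelianGeometry.EtaleTheta.SettingModel

end
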